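import Summits.CriticalPhenomena.PercolationContinuityZ3.Theorems.SahiAEPlane
import Summits.CriticalPhenomena.PercolationContinuityZ3.Theorems.SahiAEBorelVersionPi

/-!
# The planar structure theorem: a.e.-positive densities and TP₂ laws in the plane

Support file of the Sahi cell (`prim-sahi`, typer seat, generation 22; `--supports stmt-CriticalPhenomena-4575`).
Theorems only (no definitions, no named facts, no sorries).

Corollaries of `Plane.exists_measurable_mtp2_version_of_ae_plane`:

* `Plane.exists_measurable_mtp2_version_of_ae_plane'` — the hypothesis `0 < f < ∞` is needed only ALMOST
  everywhere (modify `f` on the exceptional null set; almost every pair has its members, meet and join outside it,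
  `ae_prod_mem_inf_sup_of_sigmaFinite`);
* `Plane.exists_measurable_supermodular_version_of_ae_prod` — the additive planar theorem stated on the product
  type `ℝ × ℝ` (transfer along `MeasurableEquiv.finTwoArrow`);
* `Plane.exists_tp2_density_of_isBoxTP2_plane` — **TP₂ laws in the plane**: a finite measure on `ℝ²` with an
  a.e.-positive finite density with respect to Lebesgue measure is TP₂ on closed boxes (`IsBoxTP2`, the measure-level
  lattice condition; ⟺ set-TP₂ ⟺ affiliated) if and only if it has a Borel density `F : ℝ² → (0, ∞)` which is TP₂
  (`F(x) F(y) ≤ F(x ∧ y) F(x ∨ y)`) at EVERY pair — Karlin's pointwise total positivity of order two, with NO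
  boundedness of the density (`Plane.isBoxTP2_iff_exists_tp2_density_plane`).

No sorries, no new axioms.
-/

noncomputable section

namespace Summit.CriticalPhenomena.PercolationContinuityZ3.Theorems.SahiAEFourFunctions.Plane

open MeasureTheory Set Filter Topology Function
open Summit.CriticalPhenomena.PercolationContinuityZ3.Theorems.SahiBoxTP2 (IsBoxTP2)
open scoped ENNReal NNReal

/-- **Planar structure theorem, a.e.-positive densities.**  A measurable `f : ℝ² → [0, ∞]` with `0 < f < ∞` almost
everywhere which is MTP₂ on Lebesgue-almost every pair has a measurable version with values in `(0, ∞)` which is MTP₂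
at every pair. [this work] -/
theorem exists_measurable_mtp2_version_of_ae_plane' (f : (Fin 2 → ℝ) → ℝ≥0∞) (hf : Measurable f)
    (hfin : ∀ᵐ x ∂(volume : Measure (Fin 2 → ℝ)), f x ≠ 0 ∧ f x ≠ ∞)
    (hMTP : ∀ᵐ p : (Fin 2 → ℝ) × (Fin 2 → ℝ) ∂((volume : Measure (Fin 2 → ℝ)).prod volume),
      f p.1 * f p.2 ≤ f (p.1 ⊓ p.2) * f (p.1 ⊔ p.2)) :
    ∃ F : (Fin 2 → ℝ) → ℝ≥0∞, Measurable F ∧ (∀ x, F x ≠ 0 ∧ F x ≠ ∞) ∧ F =ᵐ[volume] f ∧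
      ∀ x y, F x * F y ≤ F (x ⊓ y) * F (x ⊔ y) := by
  set G : Set (Fin 2 → ℝ) := {x | f x ≠ 0 ∧ f x ≠ ∞} with hG
  have mG : MeasurableSet G :=
    (hf (measurableSet_singleton 0)).compl.inter (hf (measurableSet_singleton ∞)).compl
  set g : (Fin 2 → ℝ) → ℝ≥0∞ := G.piecewise f (fun _ => 1) with hg
  have hgm : Measurable g := hf.piecewise mG measurable_const
  have hg_of_mem : ∀ x ∈ G, g x = f x := fun x hx => Set.piecewise_eq_of_mem _ _ _ hx
  have hg_of_not_mem : ∀ x ∉ G, g x = 1 := fun x hx => Set.piecewise_eq_of_notMem _ _ _ hx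
  have hg0 : ∀ x, g x ≠ 0 := fun x => by
    by_cases hx : x ∈ G
    · rw [hg_of_mem x hx]; exact hx.1
    · rw [hg_of_not_mem x hx]; exact one_ne_zero
  have hgT : ∀ x, g x ≠ ∞ := fun x => by
    by_cases hx : x ∈ G
    · rw [hg_of_mem x hx]; exact hx.2
    · rw [hg_of_not_mem x hx]; exact ENNReal.one_ne_top
  have hgf : g =ᵐ[volume] f := by
    filter_upwards [hfin] with x hx using hg_of_mem x hx
  have hquasi := ae_prod_mem_inf_sup_of_sigmaFinite (fun _ : Fin 2 => (volume : Measure ℝ)) (G := G)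
    (by rw [← volume_pi]; exact hfin)
  rw [← volume_pi] at hquasi
  have hgMTP : ∀ᵐ p : (Fin 2 → ℝ) × (Fin 2 → ℝ) ∂((volume : Measure (Fin 2 → ℝ)).prod volume),
      g p.1 * g p.2 ≤ g (p.1 ⊓ p.2) * g (p.1 ⊔ p.2) := by
    filter_upwards [hMTP, hquasi] with p hp hG4
    rw [hg_of_mem _ hG4.1.1, hg_of_mem _ hG4.1.2, hg_of_mem _ hG4.2.1, hg_of_mem _ hG4.2.2]
    exact hp
  obtain ⟨F, hFm, hFb, hFg, hFmtp⟩ := exists_measurable_mtp2_version_of_ae_plane g hgm hg0 hgT hgMTP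
  exact ⟨F, hFm, hFb, hFg.trans hgf, hFmtp⟩

/-- **TP₂ laws in the plane have everywhere-TP₂ densities.**  Let `f : ℝ² → [0, ∞]` be measurable, integrable,
with `0 < f < ∞` almost everywhere.  If the law `λ² · f` is TP₂ on closed boxes (`IsBoxTP2`), then `λ² · f = λ² · F`
for a Borel `F : ℝ² → (0, ∞)` with `F(x) F(y) ≤ F(x ∧ y) F(x ∨ y)` at EVERY pair; no boundedness of the density is
needed. [this work] -/
theorem exists_tp2_density_of_isBoxTP2_plane (f : (Fin 2 → ℝ) → ℝ≥0∞) (hf : Measurable f)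
    (hint : ∫⁻ z, f z ∂(volume : Measure (Fin 2 → ℝ)) ≠ ∞)
    (hfin : ∀ᵐ x ∂(volume : Measure (Fin 2 → ℝ)), f x ≠ 0 ∧ f x ≠ ∞)
    (h : IsBoxTP2 ((volume : Measure (Fin 2 → ℝ)).withDensity f)) :
    ∃ F : (Fin 2 → ℝ) → ℝ≥0∞, Measurable F ∧ (∀ x, F x ≠ 0 ∧ F x ≠ ∞) ∧
      (volume : Measure (Fin 2 → ℝ)).withDensity F = (volume : Measure (Fin 2 → ℝ)).withDensity f ∧
      ∀ x y, F x * F y ≤ F (x ⊓ y) * F (x ⊔ y) := by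
  have hae : ∀ᵐ p : (Fin 2 → ℝ) × (Fin 2 → ℝ) ∂((volume : Measure (Fin 2 → ℝ)).prod volume),
      f p.1 * f p.2 ≤ f (p.1 ⊓ p.2) * f (p.1 ⊔ p.2) := by
    have h' := (isBoxTP2_withDensity_pi_iff_ae (fun _ : Fin 2 => (volume : Measure ℝ)) f hf
      (by rw [← volume_pi]; exact hint)).1 (by rw [← volume_pi]; exact h)
    rwa [← volume_pi] at h'
  obtain ⟨F, hFm, hFb, hFf, hFmtp⟩ := exists_measurable_mtp2_version_of_ae_plane' f hf hfin hae
  exact ⟨F, hFm, hFb, withDensity_congr_ae hFf, hFmtp⟩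

/-- **Box-TP₂ ⟺ an everywhere-TP₂ positive Borel density**, for laws on the plane with an a.e.-positive finite
integrable density. [this work] -/
theorem isBoxTP2_iff_exists_tp2_density_plane (f : (Fin 2 → ℝ) → ℝ≥0∞) (hf : Measurable f)
    (hint : ∫⁻ z, f z ∂(volume : Measure (Fin 2 → ℝ)) ≠ ∞)
    (hfin : ∀ᵐ x ∂(volume : Measure (Fin 2 → ℝ)), f x ≠ 0 ∧ f x ≠ ∞) :
    IsBoxTP2 ((volume : Measure (Fin 2 → ℝ)).withDensity f) ↔
      ∃ F : (Fin 2 → ℝ) → ℝ≥0∞, Measurable F ∧ (∀ x, F x ≠ 0 ∧ F x ≠ ∞) ∧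
        (volume : Measure (Fin 2 → ℝ)).withDensity F = (volume : Measure (Fin 2 → ℝ)).withDensity f ∧
        ∀ x y, F x * F y ≤ F (x ⊓ y) * F (x ⊔ y) := by
  refine ⟨exists_tp2_density_of_isBoxTP2_plane f hf hint hfin, fun ⟨F, hFm, _, hFeq, hFmtp⟩ => ?_⟩
  rw [← hFeq, volume_pi]
  exact isBoxTP2_withDensity_pi_of_ae (fun _ : Fin 2 => (volume : Measure ℝ)) F hFm
    (Eventually.of_forall fun p => hFmtp p.1 p.2)

/-- **The planar structure theorem on `ℝ × ℝ`.**  A measurable `φ : ℝ × ℝ → ℝ` which is supermodular on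
Lebesgue-almost every pair has a measurable version supermodular at every pair. [this work] -/
theorem exists_measurable_supermodular_version_of_ae_prod (φ : ℝ × ℝ → ℝ) (hφ : Measurable φ)
    (hsm : ∀ᵐ p : (ℝ × ℝ) × (ℝ × ℝ) ∂((volume : Measure (ℝ × ℝ)).prod volume),
      φ p.1 + φ p.2 ≤ φ (p.1 ⊓ p.2) + φ (p.1 ⊔ p.2)) :
    ∃ ψ : ℝ × ℝ → ℝ, Measurable ψ ∧ ψ =ᵐ[volume] φ ∧ ∀ x y, ψ x + ψ y ≤ ψ (x ⊓ y) + ψ (x ⊔ y) := by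
  set e := (MeasurableEquiv.finTwoArrow (α := ℝ)) with he_def
  have he : MeasurePreserving e (volume : Measure (Fin 2 → ℝ)) (volume : Measure (ℝ × ℝ)) :=
    MeasureTheory.volume_preserving_finTwoArrow ℝ
  have he_apply : ∀ x : Fin 2 → ℝ, e x = (x 0, x 1) := fun x => by simp [he_def]
  have helat : ∀ x y : Fin 2 → ℝ, e (x ⊓ y) = e x ⊓ e y ∧ e (x ⊔ y) = e x ⊔ e y := fun x y => by
    simp only [he_apply, Pi.inf_apply, Pi.sup_apply, Prod.mk_inf_mk, Prod.mk_sup_mk, and_self]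
  -- pull back to `Fin 2 → ℝ`
  have hsm' : ∀ᵐ p : (Fin 2 → ℝ) × (Fin 2 → ℝ) ∂((volume : Measure (Fin 2 → ℝ)).prod volume),
      (φ ∘ e) p.1 + (φ ∘ e) p.2 ≤ (φ ∘ e) (p.1 ⊓ p.2) + (φ ∘ e) (p.1 ⊔ p.2) := by
    filter_upwards [(he.prod he).quasiMeasurePreserving.ae hsm] with p hp
    simp only [Function.comp_apply, (helat p.1 p.2).1, (helat p.1 p.2).2]
    exact hp
  obtain ⟨ψ', hψ'm, hψ'φ, hψ'sm⟩ :=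
    exists_measurable_supermodular_version_of_ae_plane (φ ∘ e) (hφ.comp e.measurable) hsm'
  refine ⟨ψ' ∘ e.symm, hψ'm.comp e.symm.measurable, ?_, fun x y => ?_⟩
  · have h1 : ∀ᵐ q ∂(volume : Measure (ℝ × ℝ)), ψ' (e.symm q) = φ (e (e.symm q)) :=
      he.symm.quasiMeasurePreserving.ae hψ'φ
    filter_upwards [h1] with q hq
    rw [Function.comp_apply, hq, e.apply_symm_apply]
  · have h := hψ'sm (e.symm x) (e.symm y)
    have hi : e.symm x ⊓ e.symm y = e.symm (x ⊓ y) := by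
      apply e.injective
      rw [(helat _ _).1, e.apply_symm_apply, e.apply_symm_apply, e.apply_symm_apply]
    have hs : e.symm x ⊔ e.symm y = e.symm (x ⊔ y) := by
      apply e.injective
      rw [(helat _ _).2, e.apply_symm_apply, e.apply_symm_apply, e.apply_symm_apply]
    simp only [Function.comp_apply]
    rwa [hi, hs] at h

end Summit.CriticalPhenomena.PercolationContinuityZ3.Theorems.SahiAEFourFunctions.Plane
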